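/-
Copyright (c) 2026 the pub-hodgecm-mathlib formalisation cell (harness21).  Prover seat hodgecm-mathlib-LH4-p08 (g5), Track A «(D-RAM) FOUR-FRAME», unit U2H, the census leaf
(ρ2b′-X) `stub_U2H_fixedPointCensus_typeTwo_unit0` — dealer LH4-plan (g12) WORD #16∕#21∕#27 hand T5a «TORIC LEVEL CENSUS» (payer LH4-p14; plan owner LH4-p12 (g4)):
sheet v5 (S1) — the level sets are FINITE, for every scalar `h` (the `hfinLS` antecedent of ★ (C1) p857559).  2026-09-04.
-/
import Summits.HodgeConjecture.HodgeConjecture.Theorems.F0P3cDyRamToricLevelCensusUnr        -- ★ p857436 (this lineage): `levelSet_eq_setOf`, ★ Flicker index, subgroups `U`, `𝒪_jˣ`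
import Summits.HodgeConjecture.HodgeConjecture.Theorems.F0P3cDyRamToricLevelCensusUnrAniso   -- ★ p857464 (this lineage): `ncard_levelSet_eq_ncard_image_mk` (generator classes, any `h`)
import HarnessLib

/-!
# T5a (S1): the level sets `levelSet(j,a)` of the toric census are FINITE — for every non-zero scalar `h` (no side split)

`levelSet ρ Θ α ϖE h j a` (★ DEFS p857239) is the set of order lattices `x₀·𝒪_j` whose dual generator `h·x₀Θx₀·ϖE^j(α − ρα)` is integral, Gram-primitive and of level
`|ϖE|^a`.  The level equation pins `|x₀|` (all generators of level-`a` members have the valuation of any one of them), so the generator classes modulo the order units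
`𝒪_jˣ` lie in the image of ONE coset `x₀·U_M`, which carries `[U_M : 𝒪_jˣ] = (q+1)q^{j−1}` classes (★ Flicker `relIndex_orderUnits_eq_of_unramified`) — finitely many.
This is sheet v5's (S1) and EXACTLY the antecedent `hfinLS : ∀ j a, (levelSet ρ Θ α (jE ϖ) h j a).Finite` of ★ (C1) `ncard_fixed_selfDual_endoGL_eq_orderForm` (p857559);
`levelSetDep ⊆ levelSet` is then finite too.
HONEST LABEL: HC_CM is proved only modulo the 7 printed citations (2 remaining named inputs: hLiu418 = stmt-HodgeConjecture-24832,
h413 = stmt-HodgeConjecture-24833) until rung 0 closes; (ρ2b′-X) :418 is an OPEN prover target — this file is a helper (`--supports`), proofs only.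
-/

set_option autoImplicit false

open WithZero IsLocalRing
open scoped Valued Pointwise

namespace Summit.HodgeConjecture.HodgeConjecture.Cruxes.H413.F0P3cDyRamToricLevelCensusUnr

open Summit.HodgeConjecture.HodgeConjecture.Cruxes.H413.F0P3cDyRamToricCensusDefs
open Literature.NumberTheory.LocalFields.QuadraticOrder Literature.NumberTheory.LocalFields.WildQuadraticDatum

variable {K : Type*} [Field K] [Valued K ℤᵐ⁰] {ρ Θ : K →+* K} {α ϖE : K}

/-- **(S1) THE LEVEL SETS ARE FINITE.**  For the M∕E-unramified frame (`|α − ρα| = 1`, `ϖE` a uniformiser, residue field of size `q²`) and ANY scalar `h` (for `h = 0` the set is empty):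
`(levelSet ρ Θ α ϖE h j a).Finite` — the generator classes of level-`a` members modulo `𝒪_jˣ` lie in the image of a single coset `x₀·U_M`, which has
`[U_M : 𝒪_jˣ] < ∞` classes. [cite: Flicker1998UnitaryFL, p. 84] [cite: Jacobowitz1962, §4] -/
theorem levelSet_finite (hρρ : ∀ x, ρ (ρ x) = x) (hvρ : ∀ x, Valued.v (ρ x) = Valued.v x) (hvΘ : ∀ x, Valued.v (Θ x) = Valued.v x)
    (hα1 : Valued.v α ≤ 1) (hα : Valued.v (α - ρ α) = 1) (hϖE : Valued.v ϖE = exp (-1 : ℤ))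
    [IsDiscreteValuationRing 𝒪[K]] [Finite 𝓀[K]] {q : ℕ} (hq : Nat.card 𝓀[K] = q ^ 2) (h : K) (j a : ℕ) :
    (levelSet ρ Θ α ϖE h j a).Finite := by
  classical
  obtain ⟨U, hU⟩ := exists_subgroup_v_eq_one (K := K)
  obtain ⟨H, hH⟩ := exists_subgroup_orderUnits (ρ := ρ) (α := α) hvρ (ϖE ^ j)
  have hvc : Valued.v (ϖE ^ j * (α - ρ α)) = exp (-(j : ℤ)) := by
    rw [map_mul, hα, mul_one, map_pow, hϖE, ← exp_nsmul, nsmul_eq_mul, mul_neg, mul_one]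
  have hq0 : 0 < q := by
    have hpos : 0 < q ^ 2 := hq ▸ Nat.card_pos
    exact Nat.pos_of_ne_zero fun h0 => by rw [h0] at hpos; exact lt_irrefl _ hpos
  -- `[U_M : 𝒪_jˣ] ≠ 0`
  have hHU0 : H.relIndex U ≠ 0 := by
    by_cases hj0 : j = 0
    · subst hj0
      rw [Subgroup.relIndex_eq_one.2]
      · exact one_ne_zero
      intro u hu
      rw [hH]
      refine ⟨(hU u).1 hu, ?_⟩
      rw [hvc]
      refine (Valuation.map_sub _ _ _).trans ?_
      rw [hvρ, (hU u).1 hu, max_self]; norm_num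
    · have hH' : ∀ u, u ∈ H ↔ Valued.v (u : K) = 1 ∧ Valued.v ((u : K) - ρ u) ≤ Valued.v (ϖE ^ j) := fun u => by
        rw [hH u, map_mul Valued.v (ϖE ^ j), hα, mul_one]
      rw [relIndex_orderUnits_eq_of_unramified hρρ hvρ hα1 hα hϖE hq (Nat.one_le_iff_ne_zero.2 hj0) U H hU hH']
      exact mul_ne_zero (by omega) (pow_ne_zero _ hq0.ne')
  by_contra hinf
  have h0 : (levelSet ρ Θ α ϖE h j a).ncard = 0 := Set.Infinite.ncard hinf
  obtain ⟨Λ, hΛ⟩ := Set.Infinite.nonempty hinf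
  rw [ncard_levelSet_eq_ncard_image_mk hvρ hϖE j a hH] at h0
  rw [levelSet_eq_setOf hϖE] at hΛ
  obtain ⟨x₀, hx₀, -, hPQ, hE⟩ := hΛ
  -- `h = 0` has no level-`a` member at all
  rcases eq_or_ne h 0 with rfl | hh
  · rw [zero_mul, zero_mul, map_zero] at hE
    exact exp_ne_zero hE.symm
  -- all generators of level-`a` members have the valuation of `x₀`: the classes lie in `mk '' (x₀ • U)`, a finite set
  have hc0 : Valued.v (ϖE ^ j * (α - ρ α)) ≠ 0 := by rw [hvc]; exact exp_ne_zero
  have hvh0 : Valued.v h ≠ 0 := (Valuation.ne_zero_iff _).2 hh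
  obtain ⟨e₀, he₀⟩ : ∃ e : ℤ, Valued.v x₀ = exp e := ⟨_, (exp_log ((Valuation.ne_zero_iff _).2 hx₀)).symm⟩
  have hfin : ((QuotientGroup.mk : Kˣ → Kˣ ⧸ H) '' (Units.mk0 x₀ hx₀ • (U : Set Kˣ))).Finite :=
    Set.finite_of_ncard_ne_zero (by rw [ncard_image_mk_smul_subgroup H U (Units.mk0 x₀ hx₀)]; exact hHU0)
  have hempty := (Set.ncard_eq_zero ?_).1 h0
  swap
  · refine hfin.subset (Set.image_mono fun x₁ hx₁ => ?_)
    have hsq : Valued.v (x₁ : K) * Valued.v (x₁ : K) = Valued.v x₀ * Valued.v x₀ := by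
      have h1 := hx₁.2
      have h2 := hE
      rw [map_mul, map_mul, map_mul, hvΘ] at h1 h2
      exact mul_left_cancel₀ hvh0 (mul_right_cancel₀ hc0 (h1.trans h2.symm))
    obtain ⟨e₁, he₁⟩ : ∃ e : ℤ, Valued.v (x₁ : K) = exp e := ⟨_, (exp_log ((Valuation.ne_zero_iff _).2 x₁.ne_zero)).symm⟩
    rw [he₁, he₀, ← exp_add, ← exp_add, exp_inj] at hsq
    rw [Set.mem_smul_set_iff_inv_smul_mem, smul_eq_mul, SetLike.mem_coe, hU, Units.val_mul, Units.val_inv_eq_inv_val, Units.val_mk0,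
      map_mul, map_inv₀, he₁, he₀, ← exp_neg, ← exp_add, ← exp_zero, exp_inj]
    omega
  have hmem : Units.mk0 x₀ hx₀ ∈ (∅ : Set Kˣ) := by
    rw [← Set.image_eq_empty.1 hempty]
    exact ⟨hPQ, hE⟩
  exact (Set.mem_empty_iff_false _).1 hmem

/-- **(S1′)** `levelSetDep(j,a;μ) ⊆ levelSet(j,a)` is finite. [cite: Jacobowitz1962, §4] -/
theorem levelSetDep_finite (hρρ : ∀ x, ρ (ρ x) = x) (hvρ : ∀ x, Valued.v (ρ x) = Valued.v x) (hvΘ : ∀ x, Valued.v (Θ x) = Valued.v x)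
    (hα1 : Valued.v α ≤ 1) (hα : Valued.v (α - ρ α) = 1) (hϖE : Valued.v ϖE = exp (-1 : ℤ))
    [IsDiscreteValuationRing 𝒪[K]] [Finite 𝓀[K]] {q : ℕ} (hq : Nat.card 𝓀[K] = q ^ 2) (h : K) (j a : ℕ) (μ : K) :
    (levelSetDep ρ Θ α ϖE h j a μ).Finite :=
  (levelSet_finite hρρ hvρ hvΘ hα1 hα hϖE hq h j a).subset fun _ hΛ => hΛ.1

end Summit.HodgeConjecture.HodgeConjecture.Cruxes.H413.F0P3cDyRamToricLevelCensusUnr
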